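import Summits.CriticalPhenomena.SAWScalingLimit.Theorems.SAWLeftRightFKGFKGToTraversalBoundBoundaryBudget
import Literature.Topology.PlaneTopology.JordanDomainLocalJoin
import HarnessLib

/-!
# Boundary budget, unit BB1: feet of facing edges; full lattice squares lie in the closed domain
(witness unit U6 of line `slit-necklace`)

Crux `SAWLeftRightFKG.FKGToTraversalBound` (stmt-CriticalPhenomena-1878), line `slit-necklace`, lead
prover-line-stmt-CriticalPhenomena-1878-c5-0; wave 6 (the BOUNDARY BUDGET `BoundaryBudget`), unit BB1.  Two registered
stubs of elementary plane topology:

* `bb_foot` — the FOOT of a boundary edge facing `∂D`: the first frontier point `F` of the open domain `D` on the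
  segment from the mesh point `a ∈ D` of the outline site to the mesh point `c` of the contact site; the half-open
  sub-segment `[a, F)` lies in `D` and `dist F a ≤ dist c a`.  Proof: `F := a + s⋆ • (c - a)` with `s⋆` the
  infimum of the closed nonempty set of parameters `s ∈ [0, 1]` mapped to the frontier; an initial piece
  `{a + s • (c - a) : 0 ≤ s ≤ s'}` (`s' < s⋆`) is connected, contains `a ∈ D` and misses `frontier D`, hence lies
  in `D` (`IsPreconnected.subset_left_of_subset_union` with the open sets `D`, `(closure D)ᶜ`).
* `bb_fullSquare` — a closed lattice square of mesh `δ` whose four sides lie in `closure D` lies in `closure D`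
  (`D` a Dobrushin, in particular Jordan, domain).  Proof: the exterior `(closure D)ᶜ` is the image of
  `{z : 1 < ‖z‖}` under a Schoenflies homeomorphism (`exists_schoenflies`), hence connected; it misses the sides,
  so it is covered by the open square and the complement of the closed square (disjoint open sets); it has points
  far away (`closure D` is bounded), so it misses the closed square altogether.

All statements folklore; no literature fact is introduced; nothing restates the crux.
-/

noncomputable section

open Filter Topology Set Metric
open Literature.Probability.LatticeModels
open Literature.Probability.RandomPlanarGeometry
open Literature.Topology.PlaneTopology

namespace Summit.CriticalPhenomena.SAWScalingLimit.Theorems.FKGToTraversalBound.SlitNecklace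

/-! ### The foot of a facing edge -/

/-- Points of the initial sub-segment `segment ℝ a (a + s • v)` (`0 ≤ s`) are the `a + s' • v`, `0 ≤ s' ≤ s`.
[folklore] -/
private theorem bbf_mem_subsegment {a v z : ℂ} {s : ℝ} (hs : 0 ≤ s) (hz : z ∈ segment ℝ a (a + s • v)) :
    ∃ s' : ℝ, 0 ≤ s' ∧ s' ≤ s ∧ z = a + s' • v := by
  rw [segment_eq_image'] at hz
  obtain ⟨θ, ⟨hθ0, hθ1⟩, rfl⟩ := hz
  refine ⟨θ * s, mul_nonneg hθ0 hs, mul_le_of_le_one_left hs hθ1, ?_⟩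
  simp only [add_sub_cancel_left, smul_smul]

/-- **The foot of a segment leaving an open set.**  If `a ∈ Ω` (`Ω` open) and the segment `[a, c]` meets
`frontier Ω`, then there is a FIRST frontier point `F ≠ a` on it: `[a, F) ⊆ Ω`, and `dist F a ≤ dist c a`.
[folklore] -/
private theorem bbf_foot_of_isOpen {Ω : Set ℂ} {a c : ℂ} (hΩ : IsOpen Ω) (ha : a ∈ Ω)
    (h : (segment ℝ a c ∩ frontier Ω).Nonempty) :
    ∃ F : ℂ, F ∈ frontier Ω ∧ F ∈ segment ℝ a c ∧ F ≠ a ∧ (∀ z ∈ segment ℝ a F, z ≠ F → z ∈ Ω) ∧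
      dist F a ≤ dist c a := by
  have hγc : Continuous fun s : ℝ => a + s • (c - a) :=
    continuous_const.add (continuous_id.smul continuous_const)
  have hseg : segment ℝ a c = (fun s : ℝ => a + s • (c - a)) '' Icc 0 1 := segment_eq_image' ℝ a c
  obtain ⟨T, hmem⟩ : ∃ T : Set ℝ, ∀ s, s ∈ T ↔ (0 ≤ s ∧ s ≤ 1) ∧ a + s • (c - a) ∈ frontier Ω :=
    ⟨Icc 0 1 ∩ (fun s : ℝ => a + s • (c - a)) ⁻¹' frontier Ω, fun _ => Iff.rfl⟩
  have hTeq : T = Icc 0 1 ∩ (fun s : ℝ => a + s • (c - a)) ⁻¹' frontier Ω := Set.ext hmem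
  have hTc : IsClosed T := by
    rw [hTeq]
    exact isClosed_Icc.inter (isClosed_frontier.preimage hγc)
  have hTn : T.Nonempty := by
    obtain ⟨F, hF, hFf⟩ := h
    rw [hseg] at hF
    obtain ⟨s, hs, rfl⟩ := hF
    exact ⟨s, (hmem s).2 ⟨hs, hFf⟩⟩
  have hTb : BddBelow T := ⟨0, fun s hs => ((hmem s).1 hs).1.1⟩
  obtain ⟨⟨h0, h1⟩, hfr⟩ := (hmem _).1 (hTc.csInf_mem hTn hTb)
  have hfr_eq : frontier Ω = closure Ω \ Ω := hΩ.frontier_eq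
  refine ⟨a + sInf T • (c - a), hfr, ?_, ?_, ?_, ?_⟩
  · rw [hseg]
    exact ⟨sInf T, ⟨h0, h1⟩, rfl⟩
  · intro hFa
    rw [hFa, hfr_eq] at hfr
    exact hfr.2 ha
  · intro z hz hzF
    obtain ⟨s', hs'0, hs'le, rfl⟩ := bbf_mem_subsegment h0 hz
    -- no parameter `t ≤ s'` is mapped to the frontier, as `s' < sInf T`
    have hs'lt : s' < sInf T := lt_of_le_of_ne hs'le fun h => hzF (by rw [h])
    have hmiss : ∀ t, 0 ≤ t → t ≤ s' → a + t • (c - a) ∉ frontier Ω := by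
      intro t ht0 ht htf
      have : sInf T ≤ t := csInf_le hTb ((hmem t).2 ⟨⟨ht0, ht.trans (hs'le.trans h1)⟩, htf⟩)
      linarith
    -- the connected initial piece contains `a ∈ Ω` and misses the frontier, so it lies in `Ω`
    have hpre : IsPreconnected ((fun s : ℝ => a + s • (c - a)) '' Icc 0 s') :=
      isPreconnected_Icc.image _ hγc.continuousOn
    have hcov : (fun s : ℝ => a + s • (c - a)) '' Icc 0 s' ⊆ Ω ∪ (closure Ω)ᶜ := by
      rintro _ ⟨t, ht, rfl⟩
      by_contra hh
      simp only [mem_union, mem_compl_iff, not_or, not_not] at hh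
      exact hmiss t ht.1 ht.2 (by rw [hfr_eq]; exact ⟨hh.2, hh.1⟩)
    have hsub : (fun s : ℝ => a + s • (c - a)) '' Icc 0 s' ⊆ Ω :=
      hpre.subset_left_of_subset_union hΩ isClosed_closure.isOpen_compl
        (disjoint_compl_right.mono_left subset_closure) hcov ⟨a, ⟨0, ⟨le_rfl, hs'0⟩, by simp⟩, ha⟩
    exact hsub ⟨s', ⟨hs'0, le_rfl⟩, rfl⟩
  · rw [dist_eq_norm, dist_eq_norm, add_sub_cancel_left, norm_smul, Real.norm_of_nonneg h0]
    exact mul_le_of_le_one_left (norm_nonneg _) h1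

/-- **Registered stub `bb_foot` (U6, BB1): the foot of a facing edge.**  For a boundary edge `e` whose outline mesh
point `a` lies in the (open) Dobrushin domain `D` and whose unit segment towards the contact mesh point `c` meets
`∂D`, there is a first frontier point `F ≠ a` on that segment, with `[a, F) ⊆ D` and `dist F a ≤ dist c a`.
[folklore] -/
theorem bb_foot : ∀ (D : DobrushinDomain) (δ : ℝ) (e : Site 2 × ODir), meshPoint δ (bsite e) ∈ D.carrier → FacesBoundary D.carrier δ e → ∃ F : ℂ, F ∈ frontier D.carrier ∧ F ∈ segment ℝ (meshPoint δ (bsite e)) (meshPoint δ (bcontact e)) ∧ F ≠ meshPoint δ (bsite e) ∧ (∀ z ∈ segment ℝ (meshPoint δ (bsite e)) F, z ≠ F → z ∈ D.carrier) ∧ dist F (meshPoint δ (bsite e)) ≤ dist (meshPoint δ (bcontact e)) (meshPoint δ (bsite e)) := by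
  intro D δ e ha hface
  exact bbf_foot_of_isOpen D.isOpen ha hface

/-! ### Full squares lie in the closed domain -/

/-- A point on the vertical line through `a` and `b`, with imaginary part between theirs, lies on `segment ℝ a b`.
[folklore] -/
private theorem bbq_mem_segment_of_re {a b p : ℂ} (hp : p.re = a.re) (hb : b.re = a.re)
    (h₁ : a.im ≤ p.im) (h₂ : p.im ≤ b.im) : p ∈ segment ℝ a b := by
  rcases eq_or_lt_of_le (h₁.trans h₂) with hab | hab
  · have : p = a := Complex.ext hp (le_antisymm (hab ▸ h₂) h₁)
    rw [this]
    exact left_mem_segment ℝ a b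
  · have hd : 0 < b.im - a.im := sub_pos.2 hab
    refine ⟨1 - (p.im - a.im) / (b.im - a.im), (p.im - a.im) / (b.im - a.im), ?_, ?_, by ring, ?_⟩
    · exact sub_nonneg.2 (div_le_one_of_le₀ (by linarith) hd.le)
    · exact div_nonneg (by linarith) hd.le
    · apply Complex.ext
      · simp only [Complex.add_re, Complex.smul_re, smul_eq_mul, hb, hp]
        ring
      · simp only [Complex.add_im, Complex.smul_im, smul_eq_mul]
        field_simp
        ring

/-- A point on the horizontal line through `a` and `b`, with real part between theirs, lies on `segment ℝ a b`.
[folklore] -/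
private theorem bbq_mem_segment_of_im {a b p : ℂ} (hp : p.im = a.im) (hb : b.im = a.im)
    (h₁ : a.re ≤ p.re) (h₂ : p.re ≤ b.re) : p ∈ segment ℝ a b := by
  rcases eq_or_lt_of_le (h₁.trans h₂) with hab | hab
  · have : p = a := Complex.ext (le_antisymm (hab ▸ h₂) h₁) hp
    rw [this]
    exact left_mem_segment ℝ a b
  · have hd : 0 < b.re - a.re := sub_pos.2 hab
    refine ⟨1 - (p.re - a.re) / (b.re - a.re), (p.re - a.re) / (b.re - a.re), ?_, ?_, by ring, ?_⟩
    · exact sub_nonneg.2 (div_le_one_of_le₀ (by linarith) hd.le)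
    · exact div_nonneg (by linarith) hd.le
    · apply Complex.ext
      · simp only [Complex.add_re, Complex.smul_re, smul_eq_mul]
        field_simp
        ring
      · simp only [Complex.add_im, Complex.smul_im, smul_eq_mul, hb, hp]
        ring

/-- Coordinates of the east neighbour. [folklore] -/
private theorem bbq_E0 (x : Site 2) : (x + ODir.vec 0) 0 = x 0 + 1 := by
  simp [ODir.vec]

/-- Coordinates of the east neighbour. [folklore] -/
private theorem bbq_E1 (x : Site 2) : (x + ODir.vec 0) 1 = x 1 := by
  simp [ODir.vec]

/-- Coordinates of the north neighbour. [folklore] -/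
private theorem bbq_N0 (x : Site 2) : (x + ODir.vec 1) 0 = x 0 := by
  simp [ODir.vec]

/-- Coordinates of the north neighbour. [folklore] -/
private theorem bbq_N1 (x : Site 2) : (x + ODir.vec 1) 1 = x 1 + 1 := by
  simp [ODir.vec]

/-- The exterior of a Dobrushin domain is connected (Schoenflies: it is the image of `{z : 1 < ‖z‖}`).
[folklore] -/
private theorem bbq_isPreconnected_exterior (D : DobrushinDomain) : IsPreconnected (closure D.carrier)ᶜ := by
  obtain ⟨H, -, -, hcl⟩ := exists_schoenflies D.toJordanDomain
  have h1 : (closure D.carrier)ᶜ = H '' (closedBall (0 : ℂ) 1)ᶜ := by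
    rw [Set.image_compl_eq H.bijective, hcl]
  have h2 : (closedBall (0 : ℂ) 1)ᶜ = {z : ℂ | 1 < ‖z‖} := by
    ext z
    simp [not_le]
  rw [h1, h2]
  exact ((isConnected_setOf_lt_norm zero_le_one).image H H.continuous.continuousOn).isPreconnected

/-- The planar core of `bb_fullSquare`, in coordinates: if the four sides of the closed square
`[x₀, x₀ + δ] × [y₀, y₀ + δ]` lie in `closure D`, so does the whole square. [folklore] -/
private theorem bbq_square_subset (D : DobrushinDomain) {x₀ y₀ δ : ℝ}
    (hside : ∀ w : ℂ, (x₀ ≤ w.re ∧ w.re ≤ x₀ + δ ∧ y₀ ≤ w.im ∧ w.im ≤ y₀ + δ) →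
      (w.re = x₀ ∨ w.re = x₀ + δ ∨ w.im = y₀ ∨ w.im = y₀ + δ) → w ∈ closure D.carrier)
    {p : ℂ} (hp : x₀ ≤ p.re ∧ p.re ≤ x₀ + δ ∧ y₀ ≤ p.im ∧ p.im ≤ y₀ + δ) : p ∈ closure D.carrier := by
  by_contra hpc
  have hUo : IsOpen {w : ℂ | x₀ < w.re ∧ w.re < x₀ + δ ∧ y₀ < w.im ∧ w.im < y₀ + δ} :=
    (isOpen_lt continuous_const Complex.continuous_re).and <|
      (isOpen_lt Complex.continuous_re continuous_const).and <|
        (isOpen_lt continuous_const Complex.continuous_im).and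
          (isOpen_lt Complex.continuous_im continuous_const)
  have hQc : IsClosed {w : ℂ | x₀ ≤ w.re ∧ w.re ≤ x₀ + δ ∧ y₀ ≤ w.im ∧ w.im ≤ y₀ + δ} :=
    (isClosed_le continuous_const Complex.continuous_re).and <|
      (isClosed_le Complex.continuous_re continuous_const).and <|
        (isClosed_le continuous_const Complex.continuous_im).and
          (isClosed_le Complex.continuous_im continuous_const)
  -- the exterior misses the sides, so it is covered by the open square and the complement of the closed square
  have hcov : (closure D.carrier)ᶜ ⊆ {w : ℂ | x₀ < w.re ∧ w.re < x₀ + δ ∧ y₀ < w.im ∧ w.im < y₀ + δ} ∪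
      {w : ℂ | x₀ ≤ w.re ∧ w.re ≤ x₀ + δ ∧ y₀ ≤ w.im ∧ w.im ≤ y₀ + δ}ᶜ := by
    intro w hw
    by_cases hwQ : x₀ ≤ w.re ∧ w.re ≤ x₀ + δ ∧ y₀ ≤ w.im ∧ w.im ≤ y₀ + δ
    · left
      obtain ⟨hq1, hq2, hq3, hq4⟩ := hwQ
      rcases eq_or_lt_of_le hq1 with h1 | h1
      · exact absurd (hside w ⟨hq1, hq2, hq3, hq4⟩ (Or.inl h1.symm)) hw
      rcases eq_or_lt_of_le hq2 with h2 | h2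
      · exact absurd (hside w ⟨hq1, hq2, hq3, hq4⟩ (Or.inr (Or.inl h2))) hw
      rcases eq_or_lt_of_le hq3 with h3 | h3
      · exact absurd (hside w ⟨hq1, hq2, hq3, hq4⟩ (Or.inr (Or.inr (Or.inl h3.symm)))) hw
      rcases eq_or_lt_of_le hq4 with h4 | h4
      · exact absurd (hside w ⟨hq1, hq2, hq3, hq4⟩ (Or.inr (Or.inr (Or.inr h4)))) hw
      exact ⟨h1, h2, h3, h4⟩
    · exact Or.inr hwQ
  -- a far point of the exterior outside the square
  have hfar : ((closure D.carrier)ᶜ ∩ {w : ℂ | x₀ ≤ w.re ∧ w.re ≤ x₀ + δ ∧ y₀ ≤ w.im ∧ w.im ≤ y₀ + δ}ᶜ).Nonempty := by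
    obtain ⟨r, hr, hsub⟩ := D.isBounded.closure.subset_closedBall_lt (max 0 (x₀ + δ)) (0 : ℂ)
    have hr0 : 0 < r := lt_of_le_of_lt (le_max_left _ _) hr
    have hr1 : x₀ + δ < r := lt_of_le_of_lt (le_max_right _ _) hr
    refine ⟨((r + 1 : ℝ) : ℂ), fun h => ?_, fun h => ?_⟩
    · have := hsub h
      rw [mem_closedBall_zero_iff, Complex.norm_real, Real.norm_of_nonneg (by linarith)] at this
      linarith
    · have := h.2.1
      rw [Complex.ofReal_re] at this
      linarith
  have hUQ : {w : ℂ | x₀ < w.re ∧ w.re < x₀ + δ ∧ y₀ < w.im ∧ w.im < y₀ + δ} ⊆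
      {w : ℂ | x₀ ≤ w.re ∧ w.re ≤ x₀ + δ ∧ y₀ ≤ w.im ∧ w.im ≤ y₀ + δ} :=
    fun w hw => ⟨hw.1.le, hw.2.1.le, hw.2.2.1.le, hw.2.2.2.le⟩
  have hsub := (bbq_isPreconnected_exterior D).subset_right_of_subset_union hUo hQc.isOpen_compl
    (disjoint_compl_right.mono_left hUQ) hcov hfar
  exact hsub hpc hp

/-- **Registered stub `bb_fullSquare` (U6, BB1): full squares lie in the closed domain.**  If the four corners
`x`, `x + E`, `x + N`, `x + E + N` of a lattice square have mesh points in the Dobrushin domain `D` and its four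
closed sides (at mesh `δ > 0`) lie in `closure D`, then the whole closed square lies in `closure D`: the exterior
`(closure D)ᶜ` is connected (Schoenflies) with far-away points and misses the sides, so it misses the square.
[folklore] -/
theorem bb_fullSquare : ∀ (D : DobrushinDomain) (δ : ℝ) (x : Site 2), 0 < δ → meshPoint δ x ∈ D.carrier → meshPoint δ (x + ODir.vec 0) ∈ D.carrier → meshPoint δ (x + ODir.vec 1) ∈ D.carrier → meshPoint δ (x + ODir.vec 0 + ODir.vec 1) ∈ D.carrier → segment ℝ (meshPoint δ x) (meshPoint δ (x + ODir.vec 0)) ⊆ closure D.carrier → segment ℝ (meshPoint δ x) (meshPoint δ (x + ODir.vec 1)) ⊆ closure D.carrier → segment ℝ (meshPoint δ (x + ODir.vec 0)) (meshPoint δ (x + ODir.vec 0 + ODir.vec 1)) ⊆ closure D.carrier → segment ℝ (meshPoint δ (x + ODir.vec 1)) (meshPoint δ (x + ODir.vec 0 + ODir.vec 1)) ⊆ closure D.carrier → ∀ p : ℂ, ((meshPoint δ x).re ≤ (p).re ∧ (p).re ≤ (meshPoint δ x).re + δ ∧ (meshPoint δ x).im ≤ (p).im ∧ (p).im ≤ (meshPoint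 δ x).im + δ) → p ∈ closure D.carrier := by
  intro D δ x _ _ _ _ _ hS hW hE hN p hp
  -- coordinates of the four corners
  have hx₀ : (meshPoint δ x).re = δ * x 0 := meshPoint_re δ x
  have hy₀ : (meshPoint δ x).im = δ * x 1 := meshPoint_im δ x
  have hEre : (meshPoint δ (x + ODir.vec 0)).re = δ * x 0 + δ := by
    rw [meshPoint_re, bbq_E0]; push_cast; ring
  have hEim : (meshPoint δ (x + ODir.vec 0)).im = δ * x 1 := by
    rw [meshPoint_im, bbq_E1]
  have hNre : (meshPoint δ (x + ODir.vec 1)).re = δ * x 0 := by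
    rw [meshPoint_re, bbq_N0]
  have hNim : (meshPoint δ (x + ODir.vec 1)).im = δ * x 1 + δ := by
    rw [meshPoint_im, bbq_N1]; push_cast; ring
  have hENre : (meshPoint δ (x + ODir.vec 0 + ODir.vec 1)).re = δ * x 0 + δ := by
    rw [meshPoint_re, bbq_N0, bbq_E0]; push_cast; ring
  have hENim : (meshPoint δ (x + ODir.vec 0 + ODir.vec 1)).im = δ * x 1 + δ := by
    rw [meshPoint_im, bbq_N1, bbq_E1]; push_cast; ring
  rw [hx₀, hy₀] at hp
  refine bbq_square_subset D (x₀ := δ * x 0) (y₀ := δ * x 1) (δ := δ) (fun w hw hside => ?_) hp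
  obtain ⟨hw1, hw2, hw3, hw4⟩ := hw
  rcases hside with h | h | h | h
  · -- west side `re = x₀`: on `[x, x + N]`
    exact hW (bbq_mem_segment_of_re (by rw [h, hx₀]) (by rw [hNre, hx₀]) (by rw [hy₀]; exact hw3)
      (by rw [hNim]; exact hw4))
  · -- east side `re = x₀ + δ`: on `[x + E, x + E + N]`
    exact hE (bbq_mem_segment_of_re (by rw [h, hEre]) (by rw [hENre, hEre]) (by rw [hEim]; exact hw3)
      (by rw [hENim]; exact hw4))
  · -- south side `im = y₀`: on `[x, x + E]`
    exact hS (bbq_mem_segment_of_im (by rw [h, hy₀]) (by rw [hEim, hy₀]) (by rw [hx₀]; exact hw1)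
      (by rw [hEre]; exact hw2))
  · -- north side `im = y₀ + δ`: on `[x + N, x + E + N]`
    exact hN (bbq_mem_segment_of_im (by rw [h, hNim]) (by rw [hENim, hNim]) (by rw [hNre]; exact hw1)
      (by rw [hENre]; exact hw2))

end Summit.CriticalPhenomena.SAWScalingLimit.Theorems.FKGToTraversalBound.SlitNecklace

end
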